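import Summits.BirchSwinnertonDyer.BirchSwinnertonDyer.Theorems.SchneiderFreeAdditiveX3GordCellThreeOfPrintTorsion
import Summits.BirchSwinnertonDyer.BirchSwinnertonDyer.Theorems.EisensteinPrimesTeichmullerPairUnramifiedAtMult
import Summits.BirchSwinnertonDyer.BirchSwinnertonDyer.Theorems.EisensteinPrimesKatzLineExistsOfTeichmuller
import Summits.BirchSwinnertonDyer.BirchSwinnertonDyer.Theorems.EisensteinPrimesGoodLatticeHeckeCharOfTeichmuller
import Summits.BirchSwinnertonDyer.BirchSwinnertonDyer.Theorems.EisensteinPrimesGoodLatticeOmegaPrelims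
import Summits.BirchSwinnertonDyer.Rank1Residual.Additive.TwistedOrdinaryLineOfTwist
import Summits.BirchSwinnertonDyer.Rank1Residual.Partition.AnticyclotomicControlJSWEmbAt
import Literature.NumberTheory.GaloisRepresentations.ArtinRestriction
import HarnessLib

/-!
# Route `SchneiderFreeAdditiveX3` (K1 door): the analytic comparison data AUX3 of the per-datum (G-ord, `e = 2`) door at `p = 3`
# EXIST — one member of the Teichmüller pair of every rational `3`-line of `W = C • V^{(−3)}` (`V` good ordinary at `3`) is UNRAMIFIED at
# `3`; its Hecke character comes from class field theory (tree) and its Katz frame from CGLS 2022 Thm. 2.1.2 (by name)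

Cell `bsd-schneider-ideate`, seat `bsd-schneider-door-c5` (prover, generation 27; assembly layer; `--supports` 19177).
PARTITION: board row B6 ∩ X3 ∩ sst-twist, `r = 1`, (G-ord, `e = 2`) half at `p = 3` (686 NAT pairs) of `Rank1Residual.partition` — PLUMBING on
top of `…GordCellThreeOfPrintTorsion` (p682313); types-the-object-of nothing; closes none of B6's cells (BSD NOT advanced).  bears_on: K1-door (19177).

WHY.  Generation 26 left the per-datum (G-ord) door at `p = 3` ∧ NAT (`KYBranchThreeTorsion.additiveIMCLowerBDPOnTree_subGordTwo_three_offSliver`)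
with ONE displayed existence hypothesis `hAUX` (memo FINDING-door-c5-g26 §4 "AUX3"): at every conjugate prime `𝔮 ∋ 3` and embedding datum
`ι′`, a residual pair `(θsub, θquot)` of `W_K[3]`, a member `θ₀` whose Hecke character `θ₀K` is unramified at `𝔮` and `𝔭`, and a Katz frame of
`θ₀K` at `(ι′, 𝔮, 𝔭)`.  This file DISCHARGES it from the tree and ONE published fact by name.

WHAT.
* §1 `fix_or_quot_of_fixedLine` (linear algebra on the `𝔽_p`-plane: an `I`-stable line against an `I`-fixed line — equal, or complementary
  with `I` trivial on the quotient); `inertia_fix_or_quot_of_goodOrd_negThree_twist` (for `W = C • V^{(−3)}`, `V` globally minimal GOOD ORDINARY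
  at `3`, every rational `3`-line `Φ ≤ W[3]` is fixed pointwise by `I_𝔓`, `𝔓 ∣ 3`, or has `I_𝔓`-trivial quotient — the `I_𝔓`-fixed line is the
  tree's TB-TOL `MixedCongruence.twistedOrdinaryLineAt_three_of_goodOrd_twist_model`, cell `b2b-bsdres`); and
  **`teichmullerPair_isUnramifiedAt_or_of_goodOrd_negThree_twist`** — the (G-ord, `e = 2`) twin of x1's [LOCp-mult]
  `TeichmullerPairUnramifiedAtMult.teichmullerPair_isUnramifiedAt_or`: ONE member of the Teichmüller pair `(θsub, θquot)` of `Φ` is UNRAMIFIED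
  at `3` (Teichmüller rigidity `apply_eq_one_of_forall_smul_eq` / `apply_eq_one_of_forall_smul_sub_mem`; one prime above the place suffices).
  This is CGLS §2.2's labelling "`φ, ψ` with `p ∤ cond(φ)`" for the reducible `W[3]` of the cell, as a theorem.
* §2 `exists_teichmullerPair_member_unramified_three` (the `3`-unramified member over `ℚ` with the side conditions of CGLS Thm. 2.1.2: `(3−1)`-torsion,
  unramified above `3` and off `N_W` — Néron–Ogg–Shafarevich `isUnramifiedAt_of_isTeichmullerLiftOn(Quot)`) and **`exists_aux3_of_thm212`** —
  the ∃-body of `hAUX` VERBATIM ⟸ `thm212_exists_isKatzLFunction` (CGLS 2022 Thm. 2.1.2, PUBLISHED named fact, hypothesis `h212`) ∘ the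
  restricted pair (`isResidualPairOver_restrictField`) ∘ the Hecke character of `θ₀|_{Γ_K}` (`exists_heckeCharacter_of_pow_eq_one`, from the
  tree's Artin reciprocity theorem) ∘ `FramedGaloisRep.isUnramifiedAt_restrictField` ∘ `embAt K 3 𝔮` (`mem_asIdeal_iff_norm_embAt_lt_one`,
  `degreeOne_of_splitsIn`) ∘ (Heeg) at `3` from the split prime `𝔭`; `Cbar = ∅`, `C := N`.
* §3 **`additiveIMCLowerBDPOnTree_subGordTwo_three_offSliver_of_thm212`** — generation 26's per-datum door (F7 §5) with `hAUX` REPLACED by `h212`: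
  the (G-ord, `e = 2`) LOWER socket `AdditiveIMCLowerBDPOnTreeLeAt 3 κ 𝔭 γ ι_𝔭 (v_3 c) P` at `p = 3`, off the `d_K = −3` sliver, at every Heegner
  datum of every globally minimal `W` with `r_an = 1`, `ClassX3 W 3`, `SubGordTwo W 3` and non-anomalous twists ⟸ Kolyvagin ∧ modularity ∧
  Hsieh A ∧ LZZ ∧ Castella–Hsieh signed ∧ [DIV.dvd] ∧ [AN3] ∧ [BR3] ∧ TWELVE published facts — NO existence hypothesis, NO per-curve hypothesis.

INPUT LEDGER (G-ord, `e = 2`), `p = 3` ∧ NAT, per datum: PUBLISHED facts (typed `Prop`s, by name: the eleven of generation 26 + CGLS Thm. 2.1.2) ∪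
{[DIV.dvd] (PREPRINT, at `p = 3` beyond its printed range), [AN3] (PUB-composed at `p = 3` per memo FINDING-door-c5-g26 §2, audit pending),
[BR3] (PUBLISHED)}.  AUX3 is GONE.

HONEST FRAMING: theorems only — §1 finite group theory over tree theorems (TB-TOL, Teichmüller rigidity), §2–§3 compositions CONDITIONAL BY NAME
on the displayed statements; no definition, no named fact introduced, no `sorry`; nothing analytic is formalised (no measure or `p`-adic
`L`-function is constructed: their EXISTENCE is the cited published theorem, typed); nothing is closed; BSD proved for no curve; «closes rung: none».
References: Serre 1972 §1.11 Prop. 11 [Serre1972]; Silverman AEC X.5 Cor. 5.4, VII.4.1 [SilvermanAEC2009]; CGLS 2022 Thm. 2.1.2, §2.2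
[CastellaGrossiLeeSkinner2022]; Cassels–Fröhlich VII §5.1 [CasselsFrohlichANT1967]; Keller–Yin arXiv:2402.12781 §1.4, arXiv:2410.23241 §3
[KellerYin2024, KellerYin2024b]; this seat p682313 (gen 26 F7), x1 p-ids in `…TeichmullerPairUnramifiedAtMult`, `…KatzLineExistsOfTeichmuller`.
-/

set_option autoImplicit false
-- `Summit.<P>.<Sub>` repeats `BirchSwinnertonDyer` by the tree's layout convention (D-0017)
set_option linter.dupNamespace false

noncomputable section

open scoped Classical NumberField Pointwise

open Field NumberField IsDedekindDomain WeierstrassCurve PowerSeries Rat.HeightOneSpectrum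
  Literature.NumberTheory.EllipticCurves Literature.NumberTheory.EllipticCurves.GreenbergSelmer
  Literature.NumberTheory.GaloisRepresentations Literature.NumberTheory.GaloisCohomology
  Literature.NumberTheory.EllipticCurves.ModularForms Literature.NumberTheory.EllipticCurves.Rank1Residual
  Literature.NumberTheory.EllipticCurves.KellerYin2024 Literature.NumberTheory.EllipticCurves.CaiShuTian2014
  Literature.NumberTheory.QuadraticFields
  Literature.NumberTheory.IwasawaTheory Literature.NumberTheory.IwasawaTheory.Greenberg2016
  Literature.NumberTheory.IwasawaTheory.Greenberg2006
  Summit.BirchSwinnertonDyer.Rank1Residual Summit.BirchSwinnertonDyer.Rank1Residual.X11b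
  Summit.BirchSwinnertonDyer.Rank1Residual.X11b.AcSelmer Summit.BirchSwinnertonDyer.Rank1Residual.X11b.Halves
  Summit.BirchSwinnertonDyer.Rank1Residual.X11b.CongruenceLimit
  Summit.BirchSwinnertonDyer.Rank1Residual.Additive
  Summit.BirchSwinnertonDyer.BirchSwinnertonDyer.Theorems.SchneiderFree
  Summit.BirchSwinnertonDyer.BirchSwinnertonDyer.Theorems.SchneiderFree.KYRead
  Summit.BirchSwinnertonDyer.BirchSwinnertonDyer.Theorems.SchneiderFree.GoodMember
  Summit.BirchSwinnertonDyer.BirchSwinnertonDyer.Theses.SchneiderFreeAdditiveX3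
  Summit.BirchSwinnertonDyer.BirchSwinnertonDyer.Theorems.SchneiderFreeAdditiveX3.LZZMatch
  Summit.BirchSwinnertonDyer.BirchSwinnertonDyer.Theorems.SchneiderFreeAdditiveX3.ControlDischarged
  Summit.BirchSwinnertonDyer.BirchSwinnertonDyer.Theorems.SchneiderFreeAdditiveX3.KYBranchOnly
  Summit.BirchSwinnertonDyer.BirchSwinnertonDyer.Theorems.SchneiderFreeAdditiveX3.KYBranchThree
  Summit.BirchSwinnertonDyer.BirchSwinnertonDyer.Theorems.SchneiderFreeAdditiveX3.KYBranchThreeDoor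
  Summit.BirchSwinnertonDyer.BirchSwinnertonDyer.Theorems.SchneiderFreeAdditiveX3.KYBranchThreeLattice
  Summit.BirchSwinnertonDyer.BirchSwinnertonDyer.Theorems.SchneiderFreeAdditiveX3.KYBranchThreeTorsion
  Summit.BirchSwinnertonDyer.BirchSwinnertonDyer.Theorems.SchneiderFreeAdditiveX3.KYNonAnomalousTwist
  Summit.BirchSwinnertonDyer.BirchSwinnertonDyer.Theorems.EisensteinPrimesMuLambda
  Summit.BirchSwinnertonDyer.BirchSwinnertonDyer.Theorems.TeichmullerPairUnramifiedAtMult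
  Summit.BirchSwinnertonDyer.BirchSwinnertonDyer.Theorems.KatzLineFrame
open Literature.NumberTheory.EllipticCurves.CastellaGrossiLeeSkinner2022
  (cor126_residualCharacter_globalLift cor126_residualCharacter_localSurjective
    prop125_characterGrSelmerDual_torsion_muZero_dim prop14_residualCharacterSelmer_finite IsKatzLFunction
    thm212_exists_isKatzLFunction)

namespace Summit.BirchSwinnertonDyer.BirchSwinnertonDyer.Theorems.SchneiderFreeAdditiveX3.KYBranchThreeAux

/-! ### §1 One member of the Teichmüller pair of a rational `3`-line of `W = C • V^{(−3)}` is unramified at `3` -/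

section LinearAlgebra

variable {W : WeierstrassCurve ℚ} {p : ℕ} [hp : Fact p.Prime]

/-- **A stable line against a pointwise-fixed line.**  In `E[p]` (order `p²`) let `I` be a set of operators (a subgroup of `Γ_ℚ`), `Φ` an
`I`-STABLE line and `L` a line FIXED POINTWISE by `I`.  Then either `I` fixes `Φ` pointwise (`Φ = L`) or `I` acts trivially on `E[p]/Φ`
(`Φ ⊓ L = ⊥`, so `E[p] = Φ ⊕ L` and `gP − P = (ga − a) + (gl − l) = ga − a ∈ Φ`).  Pure linear algebra on the `𝔽_p`-plane.
[cite: Serre1972, §1.11 (shape of E[p] at inertia)] -/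
theorem fix_or_quot_of_fixedLine [W.IsElliptic] {I : Subgroup (absoluteGaloisGroup ℚ)} {Φ L : AddSubgroup (geomTorsion W (p : ℤ))}
    (hΦ : Nat.card Φ = p) (hΦst : ∀ g ∈ I, ∀ P ∈ Φ, g • P ∈ Φ) (hL : Nat.card L = p)
    (hLfix : ∀ g ∈ I, ∀ P ∈ L, g • P = P) :
    (∀ g ∈ I, ∀ P ∈ Φ, g • P = P) ∨ (∀ g ∈ I, ∀ P : geomTorsion W (p : ℤ), g • P - P ∈ Φ) := by
  rcases line_eq_or_inf_eq_bot hΦ hL with heq | hinf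
  · exact Or.inl fun g hg P hP ↦ hLfix g hg P (heq ▸ hP)
  · refine Or.inr fun g hg P ↦ ?_
    have hne : Φ ≠ L := fun h ↦ by
      rw [h, inf_idem] at hinf
      haveI : Finite L := Nat.finite_of_card_ne_zero (by rw [hL]; exact hp.out.ne_zero)
      have h1 := hL
      rw [hinf, AddSubgroup.card_bot] at h1
      exact hp.out.one_lt.ne h1
    obtain ⟨-, hsup⟩ := SemistableTwistLocalAnyLine.inf_eq_bot_and_sup_eq_top_of_ne hp.out
      (Rank1Residual.natCard_geomTorsion W p) hΦ hL hne
    have hx : P ∈ Φ ⊔ L := by rw [hsup]; exact AddSubgroup.mem_top _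
    obtain ⟨a, ha, l, hl, rfl⟩ := AddSubgroup.mem_sup.mp hx
    rw [smul_add, hLfix g hg l hl, add_sub_add_right_eq_sub]
    exact Φ.sub_mem (hΦst g hg a ha) ha

end LinearAlgebra

section Twist

variable {V W : WeierstrassCurve ℚ} [V.IsElliptic] [V.IsGloballyMinimal] [W.IsElliptic]

/-- **At `3`, the inertia group fixes a rational `3`-line of `W = C • V^{(−3)}` pointwise or acts trivially on its quotient** (`V`
globally minimal with GOOD ORDINARY reduction at `3`, `v ∋ 3`, `𝔓 ∣ v`, `Φ ≤ W[3]` a rational line).  The tree's TB-TOL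
(`MixedCongruence.twistedOrdinaryLineAt_three_of_goodOrd_twist_model`: the line of `W[3]` transported from Serre's ordinary line of `V[3]` is
FIXED pointwise by `I_𝔓`, the Kummer sign `χ₋₃` cancelling the scalar `χ̄₃`) supplies an `I_𝔓`-fixed line; §1's linear algebra does the
rest.  ("`W[3]|_{I_3} ≅ 𝟙 ⊕ ω`": of the two characters of a reducible `W[3]`, exactly the one NOT carrying the fixed line is ramified.)
[cite: Serre1972, §1.11 Prop. 11] [cite: SilvermanAEC2009, X.5 Cor. 5.4] -/
theorem inertia_fix_or_quot_of_goodOrd_negThree_twist (hgood : V.HasGoodReductionAtPrime 3)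
    (hord : ¬ (3 : ℤ) ∣ V.frobeniusTrace 3) (C : VariableChange ℚ) (hC : C • V.quadraticTwist (-3 : ℚ) = W)
    {v : HeightOneSpectrum (𝓞 ℚ)} (hv : ((3 : ℕ) : 𝓞 ℚ) ∈ v.asIdeal)
    {𝔓 : Ideal (absIntegers (𝓞 ℚ) ℚ)} (h𝔓 : 𝔓 ∈ v.primesAbove)
    {Φ : AddSubgroup (geomTorsion W ((3 : ℕ) : ℤ))} (hΦ : IsRationalLine W 3 Φ) :
    (∀ g ∈ 𝔓.inertia (absoluteGaloisGroup ℚ), ∀ P ∈ Φ, g • P = P) ∨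
      (∀ g ∈ 𝔓.inertia (absoluteGaloisGroup ℚ), ∀ P : geomTorsion W ((3 : ℕ) : ℤ), g • P - P ∈ Φ) := by
  obtain ⟨L, hL, hLfix, -⟩ := MixedCongruence.twistedOrdinaryLineAt_three_of_goodOrd_twist_model hgood hord C hC hv h𝔓
  exact fix_or_quot_of_fixedLine hΦ.1 (fun g _ P hP ↦ hΦ.2 g P hP) hL hLfix

/-- **(G-ord, `e = 2`) twin of [LOCp-mult]: ONE member of the Teichmüller pair is unramified at `3`.**  For `V` globally minimal with good
ORDINARY reduction at `3`, `W = C • V^{(−3)}`, a rational `3`-line `Φ ≤ W[3]` and Teichmüller lifts `θsub`, `θquot : G_ℚ → GL₁(ℤ₃)` of the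
characters of `G_ℚ` on `Φ` and on `W[3]/Φ`: either `θsub` or `θquot` is UNRAMIFIED at (every place above) `3`.  From
`inertia_fix_or_quot_of_goodOrd_negThree_twist` at the chosen prime above `3` and Teichmüller rigidity
(`TeichmullerPairUnramifiedAtMult.apply_eq_one_of_forall_smul_eq`, `EisensteinPrimesMuLambda.apply_eq_one_of_forall_smul_sub_mem`; one prime
above the place suffices, `isUnramifiedAt_of_forall_mem_inertia_chosen`).  This is CGLS's labelling "`φ, ψ` with `p ∤ cond(φ)`" for the
reducible `W[3]` of the (G-ord, `e = 2`) cell, as a theorem.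
[cite: Serre1972, §1.11 Prop. 11] [cite: CastellaGrossiLeeSkinner2022, §2.2 (labelling p ∤ cond φ; arXiv:2008.02571v2 TeX L1063)]
[cite: KellerYin2024, Prop. 1.3.1 and §1.4 (arXiv:2402.12781v2) (the good ordinary untwisted twin)] -/
theorem teichmullerPair_isUnramifiedAt_or_of_goodOrd_negThree_twist (hgood : V.HasGoodReductionAtPrime 3)
    (hord : ¬ (3 : ℤ) ∣ V.frobeniusTrace 3) (C : VariableChange ℚ) (hC : C • V.quadraticTwist (-3 : ℚ) = W)
    {Φ : AddSubgroup (geomTorsion W ((3 : ℕ) : ℤ))} (hΦ : IsRationalLine W 3 Φ)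
    {θsub θquot : FramedGaloisRep ℚ (padicCoeffIntegers (∅ : Set (PadicAlgCl 3))) 1}
    (hsub : IsTeichmullerLiftOn (∅ : Set (PadicAlgCl 3)) (Φ.map (geomTorsion W ((3 : ℕ) : ℤ)).subtype) θsub)
    (hquot : IsTeichmullerLiftOnQuot (∅ : Set (PadicAlgCl 3)) (Φ.map (geomTorsion W ((3 : ℕ) : ℤ)).subtype)
      (geomTorsion W ((3 : ℕ) : ℤ)) θquot) :
    (∀ u : HeightOneSpectrum (𝓞 ℚ), ((3 : ℕ) : 𝓞 ℚ) ∈ u.asIdeal → θsub.IsUnramifiedAt u) ∨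
      (∀ u : HeightOneSpectrum (𝓞 ℚ), ((3 : ℕ) : 𝓞 ℚ) ∈ u.asIdeal → θquot.IsUnramifiedAt u) := by
  have hp : Nat.Prime 3 := Fact.out
  have hcardΦ : Nat.card (Φ.map (geomTorsion W ((3 : ℕ) : ℤ)).subtype) = 3 := by
    rw [Nat.card_congr (Φ.equivMapOfInjective (geomTorsion W ((3 : ℕ) : ℤ)).subtype
      (geomTorsion W ((3 : ℕ) : ℤ)).subtype_injective).toEquiv.symm, hΦ.1]
  have hle : Φ.map (geomTorsion W ((3 : ℕ) : ℤ)).subtype ≤ geomTorsion W ((3 : ℕ) : ℤ) := by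
    rintro _ ⟨R, _, rfl⟩
    exact R.2
  -- `ℚ` has one place above `3`
  have huniq : ∀ u u' : HeightOneSpectrum (𝓞 ℚ), ((3 : ℕ) : 𝓞 ℚ) ∈ u.asIdeal → ((3 : ℕ) : 𝓞 ℚ) ∈ u'.asIdeal → u = u' :=
    fun u u' hu hu' ↦ Rat.HeightOneSpectrum.primesEquiv.injective (Subtype.ext
      ((Rat.HeightOneSpectrum.primesEquiv_eq_of_natCast_mem u hp hu).trans
        (Rat.HeightOneSpectrum.primesEquiv_eq_of_natCast_mem u' hp hu').symm))
  obtain ⟨u₀, hu₀⟩ := Literature.NumberTheory.NumberFields.RingOfIntegers.exists_heightOneSpectrum_natCast_mem ℚ hp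
  -- the inertia group of the chosen prime above `u₀`
  have hI : ∀ g ∈ inertia (K := ℚ) u₀, g ∈ (adicCompletionPrime ℚ u₀).inertia (absoluteGaloisGroup ℚ) := fun g hg ↦ by
    rw [inertia_adicCompletionPrime_eq_map_absInertia]; exact hg
  rcases inertia_fix_or_quot_of_goodOrd_negThree_twist hgood hord C hC hu₀ (adicCompletionPrime_mem_primesAbove ℚ u₀) hΦ with
    hfix | hq
  · refine Or.inl fun u hu ↦ ?_
    rw [huniq u u₀ hu hu₀]
    refine isUnramifiedAt_of_forall_mem_inertia_chosen (∅ : Set (PadicAlgCl 3)) θsub u₀ fun g hg ↦ ?_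
    refine apply_eq_one_of_forall_smul_eq W (∅ : Set (PadicAlgCl 3)) hcardΦ hle hsub fun Q hQ ↦ ?_
    obtain ⟨R, hR, rfl⟩ := hQ
    rw [AddSubgroup.coe_subtype, ← AddSubgroup.torsionBy.coe_smul, hfix g (hI g hg) R hR]
  · refine Or.inr fun u hu ↦ ?_
    rw [huniq u u₀ hu hu₀]
    refine isUnramifiedAt_of_forall_mem_inertia_chosen (∅ : Set (PadicAlgCl 3)) θquot u₀ fun g hg ↦ ?_
    refine apply_eq_one_of_forall_smul_sub_mem W (∅ : Set (PadicAlgCl 3)) hcardΦ hquot fun Q hQ ↦ ?_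
    refine ⟨g • ⟨Q, hQ⟩ - ⟨Q, hQ⟩, hq g (hI g hg) ⟨Q, hQ⟩, ?_⟩
    rw [AddSubgroup.coe_subtype, AddSubgroupClass.coe_sub, AddSubgroup.torsionBy.coe_smul]

end Twist

/-! ### §2 AUX3: the analytic comparison data of the per-datum door at `p = 3` EXIST (modulo CGLS Thm. 2.1.2 by name) -/

section Aux

/-- **The `3`-unramified member of the Teichmüller pair over `ℚ`, with its side conditions for CGLS Thm. 2.1.2.**  For a globally minimal `W`
of the (G-ord, `e = 2`) cell at `p = 3` (`ClassX3 W 3`, `SubGordTwo W 3`; so `W = C • V^{(−3)}` with `V` globally minimal good ordinary at `3`,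
`exists_goodOrd_partner_of_subGordTwo_odd`) there are a rational `3`-line `Φ ≤ W[3]`, its Teichmüller pair `(θsub, θquot)` over `ℚ`
(`exists_teichmullerPair`) and a member `θ₀ ∈ {θsub, θquot}` which is `(3−1)`-torsion, UNRAMIFIED above `3` (§1) and unramified at every place
not dividing the conductor (Néron–Ogg–Shafarevich, `isUnramifiedAt_of_isTeichmullerLiftOn(Quot)`; `3 ∣ N_W` since `W` is additive at `3`).
[cite: Serre1972, §1.11 Prop. 11] [cite: SilvermanAEC2009, Prop. VII.4.1(a)] [cite: CastellaGrossiLeeSkinner2022, §2.2 (labelling p ∤ cond φ)] -/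
theorem exists_teichmullerPair_member_unramified_three (W : WeierstrassCurve ℚ) [W.IsElliptic] [W.IsGloballyMinimal]
    (hX : ClassX3 W 3) (hS : SubGordTwo W 3) :
    ∃ (Φ : AddSubgroup (geomTorsion W ((3 : ℕ) : ℤ))) (θsub θquot θ₀ : FramedGaloisRep ℚ (padicCoeffIntegers (∅ : Set (PadicAlgCl 3))) 1),
      IsRationalLine W 3 Φ ∧
      IsTeichmullerLiftOn (∅ : Set (PadicAlgCl 3)) (Φ.map (geomTorsion W ((3 : ℕ) : ℤ)).subtype) θsub ∧
      IsTeichmullerLiftOnQuot (∅ : Set (PadicAlgCl 3)) (Φ.map (geomTorsion W ((3 : ℕ) : ℤ)).subtype)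
        (geomTorsion W ((3 : ℕ) : ℤ)) θquot ∧
      (θ₀ = θsub ∨ θ₀ = θquot) ∧ (∀ σ : absoluteGaloisGroup ℚ, θ₀ σ ^ (3 - 1) = 1) ∧
      (∀ u : HeightOneSpectrum (𝓞 ℚ), ((3 : ℕ) : 𝓞 ℚ) ∈ u.asIdeal → θ₀.IsUnramifiedAt u) ∧
      (∀ u : HeightOneSpectrum (𝓞 ℚ), ((W.conductorNorm ℤ : ℤ) : 𝓞 ℚ) ∉ u.asIdeal → θ₀.IsUnramifiedAt u) := by
  have hp2 : (3 : ℕ) ≠ 2 := by norm_num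
  -- the good-ordinary partner `V` with `C • V^{(−3)} = W`
  obtain ⟨V, hEV, hminV, C, hC, hordV, -⟩ := exists_goodOrd_partner_of_subGordTwo_odd hp2 W hX hS
  have h3 : ((-1 : ℚ) ^ ((3 : ℕ) / 2) * ((3 : ℕ) : ℚ)) = (-3 : ℚ) := by norm_num
  rw [h3] at hC
  have hgood : V.HasGoodReductionAtPrime 3 := hordV.1
  have hord : ¬ (3 : ℤ) ∣ V.frobeniusTrace 3 := by exact_mod_cast hordV.2
  -- a rational `3`-line and its Teichmüller pair
  obtain ⟨Φ, hΦ, θsub, θquot, hsub, hquot⟩ := exists_teichmullerPair W 3 hX.1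
  have hcardΦ : Nat.card (Φ.map (geomTorsion W ((3 : ℕ) : ℤ)).subtype) = 3 := by
    rw [Nat.card_congr (Φ.equivMapOfInjective (geomTorsion W ((3 : ℕ) : ℤ)).subtype
      (geomTorsion W ((3 : ℕ) : ℤ)).subtype_injective).toEquiv.symm, hΦ.1]
  have hle : Φ.map (geomTorsion W ((3 : ℕ) : ℤ)).subtype ≤ geomTorsion W ((3 : ℕ) : ℤ) := by
    rintro _ ⟨R, _, rfl⟩
    exact R.2
  -- away from `N` (and `3 ∣ N`): Néron–Ogg–Shafarevich for both members
  have hawaysub : ∀ u : HeightOneSpectrum (𝓞 ℚ), ((W.conductorNorm ℤ : ℤ) : 𝓞 ℚ) ∉ u.asIdeal →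
      ((3 : ℕ) : 𝓞 ℚ) ∉ u.asIdeal → θsub.IsUnramifiedAt u := fun u hu hpu ↦
    isUnramifiedAt_of_isTeichmullerLiftOn W ∅ hcardΦ hle hsub (hasGoodReductionAt_of_conductorNorm_notMem W u hu) hpu
  have hawayquot : ∀ u : HeightOneSpectrum (𝓞 ℚ), ((W.conductorNorm ℤ : ℤ) : 𝓞 ℚ) ∉ u.asIdeal →
      ((3 : ℕ) : 𝓞 ℚ) ∉ u.asIdeal → θquot.IsUnramifiedAt u := fun u hu hpu ↦
    isUnramifiedAt_of_isTeichmullerLiftOnQuot W ∅ hcardΦ hquot (hasGoodReductionAt_of_conductorNorm_notMem W u hu) hpu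
  -- one member is unramified above `3`
  rcases teichmullerPair_isUnramifiedAt_or_of_goodOrd_negThree_twist hgood hord C hC hΦ hsub hquot with h3sub | h3quot
  · refine ⟨Φ, θsub, θquot, θsub, hΦ, hsub, hquot, Or.inl rfl, hsub.1, h3sub, fun u hu ↦ ?_⟩
    by_cases hpu : ((3 : ℕ) : 𝓞 ℚ) ∈ u.asIdeal
    · exact h3sub u hpu
    · exact hawaysub u hu hpu
  · refine ⟨Φ, θsub, θquot, θquot, hΦ, hsub, hquot, Or.inr rfl, hquot.1, h3quot, fun u hu ↦ ?_⟩
    by_cases hpu : ((3 : ℕ) : 𝓞 ℚ) ∈ u.asIdeal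
    · exact h3quot u hpu
    · exact hawayquot u hu hpu

/-- **AUX3 — the analytic comparison data of the per-datum (G-ord, `e = 2`) door at `p = 3` EXIST, granted CGLS 2022 Thm. 2.1.2 by name.**
For a globally minimal `W` of the cell (`ClassX3 W 3`, `SubGordTwo W 3`) of conductor `N`, an imaginary quadratic `K` with (Heeg) for `N`,
`D_K` odd `≠ −3`, the anticyclotomic tower `(κ, γ)`, a degree-one prime `𝔭 ∋ 3` and a conjugate prime `𝔮 ∋ 3` induced by the embedding
datum `ι′`: there are a residual pair `(θsub, θquot)` of `W_K[3]` (the restricted Teichmüller pair of a rational `3`-line,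
`isResidualPairOver_restrictField`), a member `θ₀` UNRAMIFIED above `3` (`exists_teichmullerPair_member_unramified_three`) with its Hecke character
`θ₀K` (class field theory, the tree's `exists_heckeCharacter_of_pow_eq_one`) unramified at `𝔮` and `𝔭` (`FramedGaloisRep.isUnramifiedAt_restrictField`
+ `IsHeckeCharOf`), `Cbar = ∅`, and a Katz frame `(ΩK₀ ≠ 0, Ωp₀ ∈ R₀ˣ, Lφ)` of `θ₀K` at `(ι′, 𝔮, 𝔭)` — CGLS Thm. 2.1.2
`thm212_exists_isKatzLFunction` (PUBLISHED named fact, hypothesis `h212`) at `θ := θ₀`, `C := N` (`3 ∣ N`: additive reduction), the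
embedding `embAt K 3 𝔮` (`mem_asIdeal_iff_norm_embAt_lt_one`).  This is the hypothesis `hAUX` of
`KYBranchThreeTorsion.additiveIMCLowerBDPOnTree_subGordTwo_three_offSliver`, discharged.
[cite: CastellaGrossiLeeSkinner2022, Thm. 2.1.2 (arXiv:2008.02571v2 TeX L1015–1041) and §2.2 (labelling)]
[cite: CasselsFrohlichANT1967, Ch. VII §5.1 Main Theorem (A) (the Hecke character of a finite-order Galois character)]
[cite: KellerYin2024, §1.4 (arXiv:2402.12781v2 TeX L1063–1086)] -/
theorem exists_aux3_of_thm212 (h212 : thm212_exists_isKatzLFunction)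
    (W : WeierstrassCurve ℚ) [W.IsElliptic] [W.IsGloballyMinimal] (hX : ClassX3 W 3) (hS : SubGordTwo W 3)
    {N : ℕ} (hN : W.conductorNorm ℤ = N)
    {K : Type} [Field K] [NumberField K] (hK : IsImaginaryQuadratic K)
    (hHe : SatisfiesHeegnerHypothesis N K) (hodd : Odd (NumberField.discr K)) (hdK : NumberField.discr K ≠ -3)
    {κ : ZpExtension K 3} (hκ : κ.IsAnticyclotomic) (γ : Field.absoluteGaloisGroup K) [Fact (κ.IsTopGenerator γ)]
    {𝔭 : HeightOneSpectrum (𝓞 K)} (h𝔭 : ((3 : ℕ) : 𝓞 K) ∈ 𝔭.asIdeal)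
    (he : 𝔭.asIdeal.ramificationIdx (𝓞 ℚ) = 1) (hf : 𝔭.asIdeal.inertiaDeg (𝓞 ℚ) = 1)
    {𝔮 : HeightOneSpectrum (𝓞 K)} (h𝔮 : ((3 : ℕ) : 𝓞 K) ∈ 𝔮.asIdeal) (hne : 𝔭 ≠ 𝔮)
    {ι' : PadicAlgCl 3 ≃+* ℂ} (hι' : BranchInducesPrime 3 ι' 𝔮) :
    ∃ (θsub θquot θ₀ : FramedGaloisRep K (padicCoeffIntegers (∅ : Set (PadicAlgCl 3))) 1)
      (θ₀K : HeckeCharacter K) (Cbar : Finset (HeightOneSpectrum (𝓞 K)))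
      (ΩK₀ : ℂ) (Ωp₀ : (unrIntegers 3)ˣ) (Lφ : UnrSeries 3),
      IsResidualPairOver (W.baseChange K) 3 θsub θquot ∧ (θ₀ = θsub ∨ θ₀ = θquot) ∧
        IsHeckeCharOf ι' θ₀ θ₀K ∧ θ₀K.IsUnramifiedAt 𝔮 ∧ θ₀K.IsUnramifiedAt 𝔭 ∧
        (∀ u ∈ Cbar, ¬ θ₀K.IsUnramifiedAt u) ∧ ΩK₀ ≠ 0 ∧
        IsKatzLFunction ι' 𝔮 𝔭 Cbar κ γ θ₀K ΩK₀ ((Ωp₀ : unrIntegers 3) : ℂ_[3]) Lφ := by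
  have hp : Nat.Prime 3 := Fact.out
  have hp2 : (3 : ℕ) ≠ 2 := by norm_num
  -- `3` splits in `K`; the conjugate prime has degree one; (Heeg) at `3`
  have hsplit : ((Ideal.span {((3 : ℕ) : ℤ)}).primesOver (𝓞 K)).ncard = 2 :=
    ncard_primesOver_eq_two_of_degreeOne hK.1 h𝔭 he hf
  obtain ⟨he', hf'⟩ := degreeOne_of_splitsIn hK.1 hsplit h𝔮
  have hHe3 : SatisfiesHeegnerHypothesis 3 K := by
    intro ℓ hℓ hℓ3
    obtain rfl : ℓ = 3 := (Nat.prime_dvd_prime_iff_eq hℓ hp).mp hℓ3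
    exact hsplit
  -- the embedding `K ↪ ℚ_3` at `𝔮`
  have hιv : ∀ x : 𝓞 K, x ∈ 𝔮.asIdeal ↔ ‖embAt K 3 𝔮 h𝔮 he' hf' (x : K)‖ < 1 :=
    fun x ↦ mem_asIdeal_iff_norm_embAt_lt_one 𝔮 h𝔮 he' hf' x
  -- the Teichmüller data over `ℚ`
  obtain ⟨Φ, θsub, θquot, θ₀, hΦ, hsub, hquot, hθ₀, hT, hunr3, hunrN⟩ :=
    exists_teichmullerPair_member_unramified_three W hX hS
  -- the Hecke character of `θ₀|_{Γ_K}`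
  have hTK : ∀ σ : absoluteGaloisGroup K, (θ₀.restrictField K) σ ^ (3 - 1) = 1 := fun σ ↦ by
    rw [FramedGaloisRep.restrictField_apply]; exact hT _
  obtain ⟨θK, -, hθK⟩ := exists_heckeCharacter_of_pow_eq_one (∅ : Set (PadicAlgCl 3)) ι' (θ₀.restrictField K) hTK
  have hθK' : IsHeckeCharOf ι' (θ₀.restrictField K) θK := hθK
  -- unramifiedness of `θ₀|_{Γ_K}` above `3`, hence of `θK`
  have hunrK : ∀ w : HeightOneSpectrum (𝓞 K), ((3 : ℕ) : 𝓞 K) ∈ w.asIdeal → (θ₀.restrictField K).IsUnramifiedAt w := by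
    intro w hw
    have h3u : ((3 : ℕ) : 𝓞 ℚ) ∈ (w.under (𝓞 ℚ)).asIdeal := by
      rw [HeightOneSpectrum.under_asIdeal, Ideal.under_def, Ideal.mem_comap, map_natCast]
      exact hw
    exact FramedGaloisRep.isUnramifiedAt_restrictField θ₀ (w := w) (v := w.under (𝓞 ℚ)) rfl (hunr3 _ h3u)
  -- the Katz frame (CGLS Thm. 2.1.2 by name), `C := N`
  have hunrN' : ∀ u : HeightOneSpectrum (𝓞 ℚ), ((N : ℤ) : 𝓞 ℚ) ∉ u.asIdeal → θ₀.IsUnramifiedAt u := by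
    intro u hu
    exact hunrN u (by rw [hN]; exact hu)
  obtain ⟨ΩK, Ωp, L, hΩK, hL⟩ := h212 3 (by norm_num) K hK hHe3 hodd hdK (embAt K 3 𝔮 h𝔮 he' hf') 𝔮 𝔭 hιv h𝔭 hne
    κ hκ γ ι' hι' θ₀ hT N hHe hunrN' hunr3 θK hθK'
  refine ⟨θsub.restrictField K, θquot.restrictField K, θ₀.restrictField K, θK, ∅, ΩK, Ωp, L,
    isResidualPairOver_restrictField W 3 K hΦ hsub hquot, ?_, hθK', (hθK 𝔮 (hunrK 𝔮 h𝔮)).1,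
    (hθK 𝔭 (hunrK 𝔭 h𝔭)).1, fun u hu ↦ absurd hu (Finset.notMem_empty u), hΩK, hL⟩
  rcases hθ₀ with rfl | rfl
  · exact Or.inl rfl
  · exact Or.inr rfl

end Aux

/-! ### §3 The per-datum (G-ord, `e = 2`) door at `p = 3` ∧ NAT with AUX3 DISCHARGED (CGLS Thm. 2.1.2 joins the published facts) -/

/-- **The (G-ord, `e = 2`) LOWER socket AT `p = 3`, off the `d_K = −3` sliver, non-anomalous twists, per Heegner datum, for EVERY globally minimal
curve of the cell — with NO existence hypothesis left**: generation 26's `KYBranchThreeTorsion.additiveIMCLowerBDPOnTree_subGordTwo_three_offSliver`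
with its comparison data `hAUX` DISCHARGED by §2 (`exists_aux3_of_thm212`).  ⟸ Kolyvagin ∧ modularity ∧ Hsieh 2014 Thm. A ∧ Liu–Zhang–Zhang 2018 ∧
Castella–Hsieh signed ∧ [DIV.dvd] (PREPRINT) ∧ [AN3] (PUB-composed at `p = 3`, audit pending) ∧ [BR3] (PUBLISHED) ∧ TWELVE published facts (the eleven
of generation 26 and CGLS 2022 Thm. 2.1.2 `thm212_exists_isKatzLFunction`).  `AdditiveIMCLowerBDPOnTreeLeAt 3 κ 𝔭 γ ι_𝔭 (v_3 c) P`.  CONDITIONAL on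
the displayed named statements; nothing asserted about BSD. [claim: KellerYin2024PotOrd, status: under-review]
[cite: KellerYin2024b, Thm. 3.3.6, Prop. 3.4.4, Thm. 3.5.1 (arXiv:2410.23241 pp. 19–20) (preprint; the Kolyvagin clause a hypothesis)]
[cite: CastellaGrossiLeeSkinner2022, Thms. 1.2.2, 2.1.2, 2.2.2, Prop. 14] [cite: CastellaHsieh2018, §3.3, Def. 3.7, Prop. 3.8]
[cite: Hsieh2014, Thm. A p. 712 (Doc. Math. 19)] [cite: LiuZhangZhang2018, Thm 1.5.1 and Thm 1.5.3 (Duke Math. J. 167 pp. 748–749)] -/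
theorem additiveIMCLowerBDPOnTree_subGordTwo_three_offSliver_of_thm212
    (hKo : ∀ (N : ℕ) [NeZero N] (W : WeierstrassCurve ℚ) (K : Type) [Field K] [NumberField K],
      Literature.NumberTheory.EllipticCurves.kolyvagin N W K)
    (hPar : nonempty_modularParametrizationData)
    (hA : Hsieh2014.thmA_exists_isHsiehLFunction_unrPeriod_anyLevel)
    (hL : LiuZhangZhang2018.thm151_thm153_modularCurve_heegnerVector_additive)
    (hCHσ : castellaHsieh2018_exists_isBranchBDPLFunction_signed)
    (hDVD : thm336_dvd_branch_OPEN) (hAN : thm351_anacong_branch_three) (hBR : thm122_charLambda_pair_three)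
    (h212 : thm212_exists_isKatzLFunction)
    (hprop125 : prop125_characterGrSelmerDual_torsion_muZero_dim) (hfact : prop14_residualCharacterSelmer_finite)
    (hlift : cor126_residualCharacter_globalLift) (hlocal : cor126_residualCharacter_localSurjective)
    (h411 : prop411_selmer_isAlmostDivisible) (h263 : prop263_sur_of_crk) (h41 : prop41_globalEulerPoincareCorank)
    (h42 : prop42_localEulerPoincareCorank) (h5A : sec5A_localH2_subsingleton_of_LOC1)
    (h32 : prop32_cohomology_isCofinitelyGenerated) :
    ∀ (W : WeierstrassCurve ℚ) [W.IsElliptic] [W.IsGloballyMinimal],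
      W.analyticRank = 1 → ClassX3 W 3 → SubGordTwo W 3 →
      (∀ (V : WeierstrassCurve ℚ) [V.IsElliptic] [V.IsGloballyMinimal] (C : VariableChange ℚ),
        GoodOrd V 3 → C • V.quadraticTwist ((-1 : ℚ) ^ (3 / 2) * (3 : ℕ)) = W → ¬ (3 : ℤ) ∣ V.frobeniusTrace 3 - 1) →
      ∀ (N : ℕ) [NeZero N] (K : Type) [Field K] [NumberField K]
        (Dt : ModularParametrizationData W N) (H : HeegnerDatum N (NumberField.discr K)) (ι : K →+* ℂ)
        (P : (W.baseChange K).toAffine.Point),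
        W.analyticRank = 1 → Additive.N10.Locus W 3 → W.conductorNorm ℤ = N → IsImaginaryQuadratic K →
        Odd (NumberField.discr K) → ¬ 3 ∣ Units.torsionOrder K → SatisfiesHeegnerHypothesis N K →
        (W.quadraticTwist (NumberField.discr K : ℚ)).entireLFunction 1 ≠ 0 →
        WeierstrassCurve.Affine.Point.map ι.toRatAlgHom P = heegnerPointComplex Dt H →
        ¬ IsOfFinAddOrder P → NumberField.discr K ≠ -3 →
        ∀ (κ : ZpExtension K 3), κ.IsAnticyclotomic →
          ∀ (γ : Field.absoluteGaloisGroup K) [Fact (κ.IsTopGenerator γ)]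
            (𝔭 : HeightOneSpectrum (𝓞 K)) (h𝔭 : ((3 : ℕ) : 𝓞 K) ∈ 𝔭.asIdeal)
            (he : 𝔭.asIdeal.ramificationIdx (𝓞 ℚ) = 1) (hf : 𝔭.asIdeal.inertiaDeg (𝓞 ℚ) = 1),
            AdditiveIMCLowerBDPOnTreeLeAt 3 κ 𝔭 γ (embAt K 3 𝔭 h𝔭 he hf) (padicValNat 3 Dt.c.natAbs) P := by
  intro W _ _ hr hX hS hna N _ K _ _ Dt H ι P hr' hloc hN hK hodd hunit hHe hL1 hP hnt hdK κ hκ γ _ 𝔭 h𝔭 he hf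
  exact KYBranchThreeTorsion.additiveIMCLowerBDPOnTree_subGordTwo_three_offSliver hKo hPar hA hL hCHσ hDVD hAN hBR hprop125 hfact
    hlift hlocal h411 h263 h41 h42 h5A h32 W hr hX hS hna N K Dt H ι P hr' hloc hN hK hodd hunit hHe hL1 hP hnt hdK κ hκ γ 𝔭 h𝔭 he hf
    (fun 𝔮 h𝔮 hne ι' hι' ↦ exists_aux3_of_thm212 h212 W hX hS hN hK hHe hodd hdK hκ γ h𝔭 he hf h𝔮 hne hι')

end Summit.BirchSwinnertonDyer.BirchSwinnertonDyer.Theorems.SchneiderFreeAdditiveX3.KYBranchThreeAux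

end
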